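import Mathlib

/-!
# Finite-horizon LQG: composition count of the block-encoded Riccati recursion and the
# matrix-free sweep (DEQ-A162)

Instance-level adjudication of specific advantage claims; no claim about BQP vs BPP or the
summit.

Source under adjudication: N. B. Dehaghani, R. Wisniewski, A. P. Aguiar, *Quantum Solution
Framework for Finite-Horizon LQG Control via Block Encodings and QSVT*, arXiv:2507.09841v1 =
IEEE QCE 2025: Algorithm 2 (quantum Riccati recursion
`U_{P_k} ← U_M + U_Aᵀ·U_{P_{k+1}}·U_A − U_2ᵀ·U_{1⁻¹}·U_2`, `U_1 = U_Bᵀ·U_{P_{k+1}}·U_B + U_N`,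
`U_2 = U_Sᵀ + U_Bᵀ·U_{P_{k+1}}·U_A`, `U_{1⁻¹} = QSVT-Invert(U_1)` with a degree-`d` polynomial,
'`O(d)` applications'), Algorithm 3 (quantum Kalman filter) and Propositions 6–8 (claimed total
cost linear in the horizon `T` and polylogarithmic in the dimension `n`).

This file kernel-checks the three elementary facts on which DEQ-A162 rests.

* §1  Composition counts (Lemma A162-1).  With `j = T − k` steps to go, the number of copies
      of the terminal encoding `U_{M_T}` inside `U_{P_k}` is `usesP d j`,
      `usesP d (j+1) = (d+3) · usesP d j` (one copy through `Aᵀ P A`, two through the two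
      occurrences of `U_2`, `d` through the inversion of `U_1`); closed form `(d+3)^j ≥ 3^j`,
      `≥ 4^j` for `d ≥ 1`, `> j` (`usesP_eq`, `three_pow_le_usesP`, `four_pow_le_usesP`,
      `lt_usesP`).  Direct copies of `U_A`: `usesA`, with `(d+2)·usesA d j + 4 = 4·(d+3)^j`
      (`usesA_closed`).  Forward pass: copies of `U_{R_0}` inside `U_{R_j}` are `(2d+4)^j`
      (`usesR_eq`).  Sub-normalisation (product rule multiplies, LCU adds): any sequence with
      `α (j+1) ≥ α_M + α_A² · α j`, `α_M ≥ 0`, satisfies `α j ≥ α_A^(2j) · α 0` (`alpha_lower`);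
      ancilla width (product rule adds widths, each LCU adds one; `U_2ᵀ · U_{1⁻¹} · U_2` holds two
      factors containing `P`): `a (j+1) ≥ 2·a j + 1` forces `a j + 1 ≥ 2^j · (a 0 + 1)`
      (`ancilla_lower`).
* §2  The matrix-free sweep (Theorem A162-3).  `ric` is the Riccati recursion
      `P_{j+1} = M + Aᵀ P_j A − (S + Aᵀ P_j B)(N + Bᵀ P_j B)⁻¹(Sᵀ + Bᵀ P_j A)`, `P_0 = M_T`,
      over any commutative ring (this is the printed recursion whenever `P_j` is symmetric,
      `ric_paper_form`); `sweep j v` computes a vector using only the maps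
      `v ↦ M v, A v, Aᵀ v, M_T v, S c, Sᵀ v, Bᵀ v`, the columns of `B` and `m × m` inverses, by
      structural recursion on `j`; `sweep_eq : sweep j v = P_j v`.  Hence the `n × m` panel
      `P_j B` — all that the controller `u_k = −(N + BᵀP_{k+1}B)⁻¹(Sᵀ + BᵀP_{k+1}A) μ_k`
      needs — is obtained from `O(j)` panel mat-vecs, never forming an `n × n` matrix
      (`panel_eq`).
* §3  Packing (the counting skeleton of Proposition A162-2): an injective map from the
      `2^(n.choose 2)` off-diagonal 0/1 patterns of a symmetric matrix to `q`-bit strings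
      forces `n.choose 2 ≤ q` (`packing`).

Nothing here is specific to quantum computation.  No `sorry`, no new axioms.
-/

namespace Summit.QuantumAdvantage.Dequantization.RiccatiSweep

open scoped Matrix

/-! ## §1  Composition counts -/

/-- copies of `U_{M_T}` inside `U_{P_{T-j}}` built by Algorithm 2 with a degree-`d` QSVT
inversion. -/
def usesP (d : ℕ) : ℕ → ℕ
  | 0 => 1
  | j + 1 => (d + 3) * usesP d j

/-- closed form of the composition count: `usesP d j = (d+3)^j`. -/
theorem usesP_eq (d j : ℕ) : usesP d j = (d + 3) ^ j := by
  induction j with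
  | zero => simp [usesP]
  | succ j ih => rw [usesP, ih, pow_succ, mul_comm]

/-- even with a degree-`0` inversion the count is at least `3^j`. -/
theorem three_pow_le_usesP (d j : ℕ) : 3 ^ j ≤ usesP d j := by
  rw [usesP_eq]
  exact Nat.pow_le_pow_left (show 3 ≤ d + 3 by omega) j

/-- with a QSVT polynomial of degree `d ≥ 1` (the only meaningful case) the count is at least
`4^j`. -/
theorem four_pow_le_usesP (d j : ℕ) (hd : 1 ≤ d) : 4 ^ j ≤ usesP d j := by
  rw [usesP_eq]
  exact Nat.pow_le_pow_left (show 4 ≤ d + 3 by omega) j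

/-- `usesP` grows faster than the horizon itself: `usesP d j > j` for every `j`, so no bound of the
form `c · T` (Propositions 6–8 of the source) can hold for the composed circuit. -/
theorem lt_usesP (d j : ℕ) : j < usesP d j :=
  calc j < 2 ^ j := Nat.lt_two_pow_self (n := j)
    _ ≤ 3 ^ j := Nat.pow_le_pow_left (show 2 ≤ 3 by norm_num) j
    _ ≤ usesP d j := three_pow_le_usesP d j

/-- direct copies of `U_A` inside `U_{P_{T-j}}`: four per level (`Aᵀ·A` and the two `U_2`). -/
def usesA (d : ℕ) : ℕ → ℕ
  | 0 => 0
  | j + 1 => 4 + (d + 3) * usesA d j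

/-- closed form of the `U_A` count: `(d+2) · usesA d j + 4 = 4 · (d+3)^j`. -/
theorem usesA_closed (d j : ℕ) : (d + 2) * usesA d j + 4 = 4 * (d + 3) ^ j := by
  induction j with
  | zero => simp [usesA]
  | succ j ih =>
    simp only [usesA, pow_succ]
    nlinarith [ih]

/-- forward pass (Algorithm 3): copies of `U_{R_0}` inside `U_{R_j}`: one through `A R Aᵀ`, one
through `V = Γ + C R Cᵀ`, and `2(d+1)` through the two occurrences of `L = W V⁻¹`. -/
def usesR (d : ℕ) : ℕ → ℕ
  | 0 => 1
  | j + 1 => (2 * d + 4) * usesR d j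

/-- closed form of the forward-pass count: `usesR d j = (2d+4)^j`. -/
theorem usesR_eq (d j : ℕ) : usesR d j = (2 * d + 4) ^ j := by
  induction j with
  | zero => simp [usesR]
  | succ j ih => rw [usesR, ih, pow_succ, mul_comm]

/-- Sub-normalisation of the composed encoding: LCU normalisations add (`α_M ≥ 0` and the dropped
correction term is non-negative), the product rule multiplies (`α_A²` from `Aᵀ · A`). -/
theorem alpha_lower (αA αM : ℝ) (hM : 0 ≤ αM) (α : ℕ → ℝ)
    (h : ∀ j, αM + αA ^ 2 * α j ≤ α (j + 1)) : ∀ j, αA ^ (2 * j) * α 0 ≤ α j := by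
  intro j
  induction j with
  | zero => simp
  | succ j ih =>
    have h2 : 0 ≤ αA ^ 2 := sq_nonneg αA
    calc αA ^ (2 * (j + 1)) * α 0 = αA ^ 2 * (αA ^ (2 * j) * α 0) := by ring
      _ ≤ αA ^ 2 * α j := mul_le_mul_of_nonneg_left ih h2
      _ ≤ αM + αA ^ 2 * α j := by linarith
      _ ≤ α (j + 1) := h j

/-- Ancilla width of the composed encoding: the product rule adds ancilla counts and each LCU adds
one, so `a (j+1) ≥ 2 · a j + 1` (two factors containing `P` inside `U_2ᵀ · U_{1⁻¹} · U_2`);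
hence `a j + 1 ≥ 2^j · (a 0 + 1)`. -/
theorem ancilla_lower (a : ℕ → ℕ) (h : ∀ j, 2 * a j + 1 ≤ a (j + 1)) :
    ∀ j, 2 ^ j * (a 0 + 1) ≤ a j + 1 := by
  intro j
  induction j with
  | zero => simp
  | succ j ih =>
    calc 2 ^ (j + 1) * (a 0 + 1) = 2 * (2 ^ j * (a 0 + 1)) := by ring
      _ ≤ 2 * (a j + 1) := Nat.mul_le_mul_left 2 ih
      _ = (2 * a j + 1) + 1 := by ring
      _ ≤ a (j + 1) + 1 := Nat.add_le_add_right (h j) 1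

/-! ## §2  The matrix-free sweep -/

section Sweep

variable {R : Type*} [CommRing R]
variable {n m : Type*} [Fintype n] [Fintype m] [DecidableEq m]
variable (A M MT : Matrix n n R) (B S : Matrix n m R) (N : Matrix m m R)

/-- The backward Riccati recursion indexed by steps-to-go `j` (`P_0 = M_T`). -/
noncomputable def ric : ℕ → Matrix n n R
  | 0 => MT
  | j + 1 =>
    M + Aᵀ * ric j * A
      - (S + Aᵀ * ric j * B) * (N + Bᵀ * ric j * B)⁻¹ * (Sᵀ + Bᵀ * ric j * A)

/-- When `P_j` is symmetric the recursion `ric` is the printed one,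
`P_{j+1} = M + AᵀP_jA − (Sᵀ + BᵀP_jA)ᵀ (N + BᵀP_jB)⁻¹ (Sᵀ + BᵀP_jA)`. -/
theorem ric_paper_form (j : ℕ) (hsym : (ric A M MT B S N j)ᵀ = ric A M MT B S N j) :
    ric A M MT B S N (j + 1) =
      M + Aᵀ * ric A M MT B S N j * A
        - (Sᵀ + Bᵀ * ric A M MT B S N j * A)ᵀ * (N + Bᵀ * ric A M MT B S N j * B)⁻¹
          * (Sᵀ + Bᵀ * ric A M MT B S N j * A) := by
  simp only [ric, Matrix.transpose_add, Matrix.transpose_mul, Matrix.transpose_transpose, hsym,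
    Matrix.mul_assoc]

/-- The matrix-free sweep: `sweep j v` uses only mat-vecs with `M, A, Aᵀ, M_T, S, Sᵀ, Bᵀ`, the
columns of `B`, and an `m × m` inverse, by structural recursion on the number of steps to go. -/
noncomputable def sweep : ℕ → (n → R) → (n → R)
  | 0, v => MT *ᵥ v
  | j + 1, v =>
    let r : n → R := sweep j (A *ᵥ v)
    let Y : Matrix n m R := Matrix.of fun i l => sweep j (fun k => B k l) i
    let F : Matrix n m R := S + Aᵀ * Y
    let G : Matrix m m R := N + Bᵀ * Y
    M *ᵥ v + Aᵀ *ᵥ r - F *ᵥ (G⁻¹ *ᵥ (Sᵀ *ᵥ v + Bᵀ *ᵥ r))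

/-- **Theorem A162-3 (algebraic core).** The sweep returns `P_j v` exactly. -/
theorem sweep_eq (j : ℕ) (v : n → R) : sweep A M MT B S N j v = ric A M MT B S N j *ᵥ v := by
  induction j generalizing v with
  | zero => simp [sweep, ric]
  | succ j ih =>
    have hY : (Matrix.of fun i l => (ric A M MT B S N j *ᵥ fun k => B k l) i)
        = ric A M MT B S N j * B := by
      ext i l
      simp [Matrix.mul_apply, Matrix.mulVec, dotProduct]
    simp only [sweep, ih, hY, ric]
    simp only [Matrix.add_mulVec, Matrix.sub_mulVec, Matrix.mulVec_add, Matrix.mulVec_mulVec,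
      Matrix.mul_assoc, Matrix.mul_add]

/-- The `n × m` panel `P_j B` is read off the sweep applied to the columns of `B`. -/
theorem panel_eq (j : ℕ) (i : n) (l : m) :
    (ric A M MT B S N j * B) i l = sweep A M MT B S N j (fun k => B k l) i := by
  simp [sweep_eq, Matrix.mul_apply, Matrix.mulVec, dotProduct]

end Sweep

/-! ## §3  Packing -/

/-- If the `2^(n.choose 2)` off-diagonal 0/1 patterns are recovered from `q` bits, then
`n.choose 2 ≤ q`. -/
theorem packing (n q : ℕ) (f : (Fin (n.choose 2) → Bool) → (Fin q → Bool))
    (hf : Function.Injective f) : n.choose 2 ≤ q := by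
  have h := Fintype.card_le_of_injective f hf
  simp only [Fintype.card_fun, Fintype.card_bool, Fintype.card_fin] at h
  exact (Nat.pow_le_pow_iff_right (by norm_num : 1 < 2)).mp h

end Summit.QuantumAdvantage.Dequantization.RiccatiSweep
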